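import Summits.CriticalPhenomena.PercolationContinuityZ3.Theorems.PercNearOneGluingNoHeavyLowerTailSunflowerPartitionLemma
import Mathlib.Analysis.SpecialFunctions.Pow.Real
import HarnessLib
import HarnessLib.Audit

/-!
# `NoHeavyLowerTail` (crux stmt-CriticalPhenomena-4575), abstract sunflower cubic: the BLOCK-SIZE structure of the partition lemma —
# the size-biased form (★_w) and the Muirhead-cone / dominance form (MUIR), typed conjectures with their reductions to `PartitionLemmaH`

Support file (seat `prim-ineq-prove-1` gen 26; `--supports stmt-CriticalPhenomena-4575`; companion of `…SunflowerPartitionLemma` (p214317)).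
Memo: run/shared/lean/prim/prim-ineq-prove-1/FINDING-MUIR-prove1-g26.md §2–§3 (statements, equivalences, census: `|α| = 3, 4` exhaustive over all monotone
maps; `|α| = 5` EXHAUSTIVE over all 7 828 354 (up-set, down-set) states with the finest colouring; random `|α| ≤ 8`; 0 violations).

* `Sunflower.ZW w₁ w₂ w₃` — the size-biased partition functional `Σ_{(P¹,P²,P³)} w₁^{|P¹|} w₂^{|P²|} w₃^{|P³|} · s6H` (a symmetric ternary form of degree `|α|`
  in `w`; `ZW 1 1 1 = ZH`).  `SizeBiasedPartitionIneq` (★_w, `@[conjecture]`): `ZW w ≥ 0` for all `w ∈ ℝ³_{≥0}` — the partition lemma under EVERY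
  exchangeable block bias; its `(1,1,0)` edge is the weighted antipodal Gladkov inequality (proved: `…SunflowerWeightedGladkov`, p218772).
* `sizeType`, `Sunflower.ZU P` — the partition functional restricted to partitions whose sorted block-size type `(a ≥ b ≥ c)` satisfies a predicate `P`;
  `MuirheadConePartitionIneq` (MUIR, `@[conjecture]`): `ZU P ≥ 0` for every `P` that is an UP-SET of the dominance (majorisation) order (`(a,b,c) ≽ (a',b',c')` iff
  `a ≥ a'` and `a+b ≥ a'+b'`, sums equal) — equivalently the
  size-graded sums lie in the Muirhead cone, equivalently a bad→good charging exists that only moves to more spread block-size types.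
* Reductions (proved): `partitionLemmaH_of_sizeBiased` (`w = (1,1,1)`), `partitionLemmaH_of_muirhead` (`P = ⊤`).  (MUIR ⟹ ★_w is Muirhead's inequality for
  three variables and is not formalised here.)
Nothing here is asserted; both conjectures are obligations (`(h : …)`), never facts. [status: open]
-/

namespace Summit.CriticalPhenomena.PercolationContinuityZ3.Theorems.SunflowerPartition

open Finset

variable {α : Type*} [Fintype α] [DecidableEq α]

namespace Sunflower

variable (F : Sunflower α)

/-- The SIZE-BIASED partition functional `ZW w₁ w₂ w₃ = Σ_{ordered 3-partitions (P¹,P²,P³)} w₁^{|P¹|} w₂^{|P²|} w₃^{|P³|} s6H(lab P¹, lab P², lab P³)`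
(`= E[s6H]·(w₁+w₂+w₃)^{|α|}` for the block assignment with probabilities `∝ w`). [this work] -/
noncomputable def ZW (w₁ w₂ w₃ : ℝ) : ℝ :=
  ∑ q ∈ parts α, w₁ ^ q.1.card * w₂ ^ q.2.card * w₃ ^ ((q.1 ∪ q.2)ᶜ).card * (s6H (F.lab q.1) (F.lab q.2) (F.lab (q.1 ∪ q.2)ᶜ) : ℝ)

/-- `ZW 1 1 1 = ZH`. [this work] -/
theorem ZW_one : F.ZW 1 1 1 = (F.ZH : ℝ) := by
  unfold ZW ZH
  push_cast
  refine sum_congr rfl fun q _ => ?_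
  simp only [one_pow, one_mul]

end Sunflower

/-- The sorted block-size type `(max, mid, min)` of three sizes. [this work] -/
def sizeType (a b c : ℕ) : ℕ × ℕ × ℕ :=
  (max (max a b) c, a + b + c - max (max a b) c - min (min a b) c, min (min a b) c)

namespace Sunflower

variable (F : Sunflower α)

/-- The partition functional restricted to the ordered 3-partitions whose block-size type satisfies `P`. [this work] -/
def ZU (P : ℕ × ℕ × ℕ → Prop) [DecidablePred P] : ℤ :=
  ∑ q ∈ parts α, if P (sizeType q.1.card q.2.card ((q.1 ∪ q.2)ᶜ).card) then s6H (F.lab q.1) (F.lab q.2) (F.lab (q.1 ∪ q.2)ᶜ) else 0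

/-- With the trivial predicate, `ZU = ZH`. [this work] -/
theorem ZU_true : F.ZU (fun _ => True) = F.ZH := by
  unfold ZU ZH
  exact sum_congr rfl fun q _ => if_pos trivial

end Sunflower

/-- **(★_w) SIZE-BIASED PARTITION INEQUALITY** (this work; OPEN; census memo §2): for every sunflower of up-sets and all real block weights
`w₁, w₂, w₃ ≥ 0`, `ZW w₁ w₂ w₃ ≥ 0` — the partition lemma `PartitionLemmaH` under every exchangeable block bias (`w = (1,1,1)` is `PartitionLemmaH`,
`w = (1,1,0)` the weighted antipodal Gladkov inequality).  An obligation, never a fact: use as `(h : SizeBiasedPartitionIneq)`. [status: open] -/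
@[conjecture] def SizeBiasedPartitionIneq : Prop :=
  ∀ (α : Type) [Fintype α] [DecidableEq α] (F : Sunflower α) (w₁ w₂ w₃ : ℝ), 0 ≤ w₁ → 0 ≤ w₂ → 0 ≤ w₃ → 0 ≤ F.ZW w₁ w₂ w₃

/-- **(MUIR) MUIRHEAD-CONE PARTITION INEQUALITY** (this work; OPEN; census memo §3, exhaustive `|α| = 5` over all (up-set, down-set) states): for every
sunflower and every predicate `P` on size types that is upward closed under dominance, the partition functional restricted to partitions of type in `P`
is `≥ 0`.  (`P = ⊤`: `PartitionLemmaH`; `P = {min block = 0}`: `3 ×` antipodal Gladkov; by Muirhead's inequality MUIR ⟹ ★_w.)  An obligation, never a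
fact: use as `(h : MuirheadConePartitionIneq)`. [status: open] -/
@[conjecture] def MuirheadConePartitionIneq : Prop :=
  ∀ (α : Type) [Fintype α] [DecidableEq α] (F : Sunflower α) (P : ℕ × ℕ × ℕ → Prop) [DecidablePred P],
    (∀ t t' : ℕ × ℕ × ℕ, P t' → t'.1 ≤ t.1 → t'.1 + t'.2.1 ≤ t.1 + t.2.1 → P t) → 0 ≤ F.ZU P

/-- ★_w ⟹ the partition lemma (`w = (1,1,1)`). [this work] -/
theorem partitionLemmaH_of_sizeBiased (h : SizeBiasedPartitionIneq) : PartitionLemmaH := by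
  intro α _ _ F
  have h1 := h α F 1 1 1 zero_le_one zero_le_one zero_le_one
  rw [F.ZW_one] at h1
  exact_mod_cast h1

/-- MUIR ⟹ the partition lemma (`P = ⊤`). [this work] -/
theorem partitionLemmaH_of_muirhead (h : MuirheadConePartitionIneq) : PartitionLemmaH := by
  intro α _ _ F
  rw [← F.ZU_true]
  exact h α F (fun _ => True) (fun _ _ _ _ _ => trivial)

end Summit.CriticalPhenomena.PercolationContinuityZ3.Theorems.SunflowerPartition
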